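import Summits.BirchSwinnertonDyer.BirchSwinnertonDyer.Theorems.Rank2ObservatoryRank2Table
import Summits.BirchSwinnertonDyer.BirchSwinnertonDyer.Theorems.Rank2ObservatoryRank2Rows00
import Summits.BirchSwinnertonDyer.BirchSwinnertonDyer.Theorems.Rank2ObservatoryRank2Rows01
import Summits.BirchSwinnertonDyer.BirchSwinnertonDyer.Theorems.Rank2ObservatoryRank2Rows02
import Summits.BirchSwinnertonDyer.BirchSwinnertonDyer.Theorems.Rank2ObservatoryRank2Rows03
import Summits.BirchSwinnertonDyer.BirchSwinnertonDyer.Theorems.Rank2ObservatoryRank2Rows04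
import Summits.BirchSwinnertonDyer.BirchSwinnertonDyer.Theorems.Rank2ObservatoryRank2Rows05
import Summits.BirchSwinnertonDyer.BirchSwinnertonDyer.Theorems.Rank2ObservatoryRank2Rows06a
import Summits.BirchSwinnertonDyer.BirchSwinnertonDyer.Theorems.Rank2ObservatoryRank2Rows06b
import Summits.BirchSwinnertonDyer.BirchSwinnertonDyer.Theorems.Rank2ObservatoryRank2Rows07a
import Summits.BirchSwinnertonDyer.BirchSwinnertonDyer.Theorems.Rank2ObservatoryRank2Rows07b
import Summits.BirchSwinnertonDyer.BirchSwinnertonDyer.Theorems.Rank2ObservatoryRank2Rows08a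
import Summits.BirchSwinnertonDyer.BirchSwinnertonDyer.Theorems.Rank2ObservatoryRank2Rows08b
import Summits.BirchSwinnertonDyer.BirchSwinnertonDyer.Theorems.Rank2ObservatoryRank2Rows09a
import Summits.BirchSwinnertonDyer.BirchSwinnertonDyer.Theorems.Rank2ObservatoryRank2Rows09b
import HarnessLib

/-!
# BirchSwinnertonDyer — rank ≥ 2 observatory: rank-2 census table, decade 0 of 10 (`0 ≤ N < 50000`)

HONEST FRAMING: per-curve certified theorems and census instruments; no claim on BSD in rank ≥ 2.

Machine-written AGGREGATION level of the rank-2 census (schema `Rank2ObservatoryRank2Table.lean`, data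
chunks `Rank2ObservatoryRank2Rows00 … 09b`, census `Rank2ObservatoryRank2Census.lean`): `rank2Decade0` is the
concatenation of the 14 chunks of conductor windows 00–09 (`0 ≤ N < 50000`; a window above the gate's
200 kB file cap is stored as two half-window chunks `NNa`, `NNb`) — rows 1–23612 of `rank2_table.tsv`
(sha256 `8b151c933b69ee8dae4834c21efd171353ae94c887716c05b7381d12d173f912`), 23612 curves from `389a1` to
`49995e1`. Its theorems are assembled from the chunk theorems (each a kernel `decide`) by
`List.all_append` / `List.length_append` rewriting only; no row is re-evaluated here. The two-level
assembly (chunks → decades → table) keeps every file under the tree's 400-line limit and every list short.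

Reference: J. E. Cremona, *Algorithms for Modular Elliptic Curves* (2nd ed. 1997), tables / ecdata.
-/

-- single-conjunct summit: `Summit.BirchSwinnertonDyer.BirchSwinnertonDyer.…` repeats the name by design
set_option linter.dupNamespace false

namespace Summit.BirchSwinnertonDyer.BirchSwinnertonDyer.Rank2Observatory

/-- The 14 chunks of decade 0 (conductors `0 ≤ N < 50000`), in order. [cite: CremonaAlgorithms1997, Tables] -/
noncomputable def rank2Decade0Chunks : List (List Rank2Row) := [
  rank2Rows00, rank2Rows01, rank2Rows02, rank2Rows03, rank2Rows04, rank2Rows05, rank2Rows06a,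
  rank2Rows06b, rank2Rows07a, rank2Rows07b, rank2Rows08a, rank2Rows08b, rank2Rows09a,
  rank2Rows09b]

/-- Decade 0 of the rank-2 census table: the 23612 rank-2 curves of conductor `0 ≤ N < 50000` (rows 1–23612).
[cite: CremonaAlgorithms1997, Tables] -/
noncomputable def rank2Decade0 : List Rank2Row :=
  rank2Decade0Chunks.flatten

/-- Every row of decade 0 satisfies `Rank2Row.check` (from the 14 chunk theorems). [folklore] -/
theorem rank2Decade0_check : rank2Decade0.all Rank2Row.check = true := by
  simp only [rank2Decade0, rank2Decade0Chunks, List.flatten_cons, List.flatten_nil, List.all_append, List.all_nil,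
    Bool.and_true,
    rank2Rows00_check, rank2Rows01_check, rank2Rows02_check, rank2Rows03_check,
    rank2Rows04_check, rank2Rows05_check, rank2Rows06a_check, rank2Rows06b_check,
    rank2Rows07a_check, rank2Rows07b_check, rank2Rows08a_check, rank2Rows08b_check,
    rank2Rows09a_check, rank2Rows09b_check]

/-- Decade 0 has `23612` rows (sum of the 14 kernel-counted chunk lengths). [cite: CremonaAlgorithms1997, Tables] -/
theorem rank2Decade0_length : rank2Decade0.length = 23612 := by
  simp only [rank2Decade0, rank2Decade0Chunks, List.flatten_cons, List.flatten_nil, List.length_append, List.length_nil,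
    rank2Rows00_length, rank2Rows01_length, rank2Rows02_length, rank2Rows03_length,
    rank2Rows04_length, rank2Rows05_length, rank2Rows06a_length, rank2Rows06b_length,
    rank2Rows07a_length, rank2Rows07b_length, rank2Rows08a_length, rank2Rows08b_length,
    rank2Rows09a_length, rank2Rows09b_length]

/-- Every conductor of decade 0 is `< 500 000` (from the 14 kernel-checked chunk ranges).
[cite: CremonaAlgorithms1997, Tables] -/
theorem rank2Decade0_conductor_lt : rank2Decade0.all (fun r => decide (r.N < 500000)) = true := by
  simp only [rank2Decade0, rank2Decade0Chunks, List.flatten_cons, List.flatten_nil, List.all_append, List.all_nil,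
    Bool.and_true,
    Rank2Row.all_conductorLt_of_all_range (by norm_num) rank2Rows00_conductor,
    Rank2Row.all_conductorLt_of_all_range (by norm_num) rank2Rows01_conductor,
    Rank2Row.all_conductorLt_of_all_range (by norm_num) rank2Rows02_conductor,
    Rank2Row.all_conductorLt_of_all_range (by norm_num) rank2Rows03_conductor,
    Rank2Row.all_conductorLt_of_all_range (by norm_num) rank2Rows04_conductor,
    Rank2Row.all_conductorLt_of_all_range (by norm_num) rank2Rows05_conductor,
    Rank2Row.all_conductorLt_of_all_range (by norm_num) rank2Rows06a_conductor,
    Rank2Row.all_conductorLt_of_all_range (by norm_num) rank2Rows06b_conductor,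
    Rank2Row.all_conductorLt_of_all_range (by norm_num) rank2Rows07a_conductor,
    Rank2Row.all_conductorLt_of_all_range (by norm_num) rank2Rows07b_conductor,
    Rank2Row.all_conductorLt_of_all_range (by norm_num) rank2Rows08a_conductor,
    Rank2Row.all_conductorLt_of_all_range (by norm_num) rank2Rows08b_conductor,
    Rank2Row.all_conductorLt_of_all_range (by norm_num) rank2Rows09a_conductor,
    Rank2Row.all_conductorLt_of_all_range (by norm_num) rank2Rows09b_conductor]

/-- A row of a chunk of decade 0 is a row of the decade. [folklore] -/
theorem mem_rank2Decade0_of_mem_chunk {l : List Rank2Row} (hl : l ∈ rank2Decade0Chunks) {r : Rank2Row} (hr : r ∈ l) :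
    r ∈ rank2Decade0 :=
  List.mem_flatten.mpr ⟨l, hl, hr⟩

/-- Chunk 00 is a chunk of decade 0. [folklore] -/
theorem rank2Rows00_mem_decade0 : rank2Rows00 ∈ rank2Decade0Chunks :=
  List.mem_iff_getElem?.mpr ⟨0, rfl⟩

/-- Chunk 01 is a chunk of decade 0. [folklore] -/
theorem rank2Rows01_mem_decade0 : rank2Rows01 ∈ rank2Decade0Chunks :=
  List.mem_iff_getElem?.mpr ⟨1, rfl⟩

/-- Chunk 02 is a chunk of decade 0. [folklore] -/
theorem rank2Rows02_mem_decade0 : rank2Rows02 ∈ rank2Decade0Chunks :=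
  List.mem_iff_getElem?.mpr ⟨2, rfl⟩

/-- Chunk 03 is a chunk of decade 0. [folklore] -/
theorem rank2Rows03_mem_decade0 : rank2Rows03 ∈ rank2Decade0Chunks :=
  List.mem_iff_getElem?.mpr ⟨3, rfl⟩

/-- Chunk 04 is a chunk of decade 0. [folklore] -/
theorem rank2Rows04_mem_decade0 : rank2Rows04 ∈ rank2Decade0Chunks :=
  List.mem_iff_getElem?.mpr ⟨4, rfl⟩

/-- Chunk 05 is a chunk of decade 0. [folklore] -/
theorem rank2Rows05_mem_decade0 : rank2Rows05 ∈ rank2Decade0Chunks :=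
  List.mem_iff_getElem?.mpr ⟨5, rfl⟩

/-- Chunk 06a is a chunk of decade 0. [folklore] -/
theorem rank2Rows06a_mem_decade0 : rank2Rows06a ∈ rank2Decade0Chunks :=
  List.mem_iff_getElem?.mpr ⟨6, rfl⟩

/-- Chunk 06b is a chunk of decade 0. [folklore] -/
theorem rank2Rows06b_mem_decade0 : rank2Rows06b ∈ rank2Decade0Chunks :=
  List.mem_iff_getElem?.mpr ⟨7, rfl⟩

/-- Chunk 07a is a chunk of decade 0. [folklore] -/
theorem rank2Rows07a_mem_decade0 : rank2Rows07a ∈ rank2Decade0Chunks :=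
  List.mem_iff_getElem?.mpr ⟨8, rfl⟩

/-- Chunk 07b is a chunk of decade 0. [folklore] -/
theorem rank2Rows07b_mem_decade0 : rank2Rows07b ∈ rank2Decade0Chunks :=
  List.mem_iff_getElem?.mpr ⟨9, rfl⟩

/-- Chunk 08a is a chunk of decade 0. [folklore] -/
theorem rank2Rows08a_mem_decade0 : rank2Rows08a ∈ rank2Decade0Chunks :=
  List.mem_iff_getElem?.mpr ⟨10, rfl⟩

/-- Chunk 08b is a chunk of decade 0. [folklore] -/
theorem rank2Rows08b_mem_decade0 : rank2Rows08b ∈ rank2Decade0Chunks :=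
  List.mem_iff_getElem?.mpr ⟨11, rfl⟩

/-- Chunk 09a is a chunk of decade 0. [folklore] -/
theorem rank2Rows09a_mem_decade0 : rank2Rows09a ∈ rank2Decade0Chunks :=
  List.mem_iff_getElem?.mpr ⟨12, rfl⟩

/-- Chunk 09b is a chunk of decade 0. [folklore] -/
theorem rank2Rows09b_mem_decade0 : rank2Rows09b ∈ rank2Decade0Chunks :=
  List.mem_iff_getElem?.mpr ⟨13, rfl⟩

end Summit.BirchSwinnertonDyer.BirchSwinnertonDyer.Rank2Observatory
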